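import Summits.BirchSwinnertonDyer.BirchSwinnertonDyer.Theses.PrintX8VS
import HarnessLib

/-!
# Route `PrintX8VS`, glue item `PublishedInputsX8CoreOfParts` (stmt-BirchSwinnertonDyer-23005): the seven
# by-name held inputs reassemble the core bundle `PublishedInputsX8Core` — PROVED (anonymous constructor)

Cell `bsd-print-x8`, seat p3 (gen 4); planner g6's turnkey (1) of 2026-08-27T22:02:44Z after the split of
`PublishedInputsX8Core` (rev 3) into its seven 1:1 cite-only children `InputBKOCorA5SharpFlat`, `InputNewform`,
`InputHondaSystem`, `InputSharpFlatTorsion`, `InputKatoSharpFlatDivisibility`, `InputLem59AllN`,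
`InputEntireLFunction`. Pure bookkeeping (the `PrintX6`/`SignedLowerHalves` idiom, cf. PrintX8's
`PrintX8Glue.publishedInputsX8OfParts_holds` p536888): nothing mathematical is asserted; the children stay
HELD published facts; no census cell moves; PARTITION 0; BSD is not proved by any of this; «beyond-print
theorem: NO». Imports the route file only (leaf closer; no other Theorems module depends on it).

References: route file `Theses/PrintX8VS.lean` rev 6 (items 23005 and the seven Input* children);
[BurungaleKobayashiOta2023] App. A Cor. A.5; [Sprung2012] Thms. 2.2, 7.14, 7.16; [Sprung2024] Lemma 5.9;
[BreuilConradDiamondTaylor2001] (modularity).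
-/

set_option autoImplicit false
-- justification: the mandated namespace `Summit.BirchSwinnertonDyer.BirchSwinnertonDyer.Theorems`
-- (single-conjunct summit, Sub = Summit) repeats a segment by design (D-0017).
set_option linter.dupNamespace false

namespace Summit.BirchSwinnertonDyer.BirchSwinnertonDyer.Theorems.PrintX8VSCoreOfParts

open Summit.BirchSwinnertonDyer.BirchSwinnertonDyer.Theses

/-- **Item 23005 `PrintX8VS.PublishedInputsX8CoreOfParts`**: the seven held inputs, by name, give the core
bundle `PublishedInputsX8Core` (their conjunction) — anonymous constructor. [cite: Sprung2012, Thm. 2.2, Thm. 7.14 and Thm. 7.16]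
[cite: BurungaleKobayashiOta2023, App. A Cor. A.5] [cite: Sprung2024, Lemma 5.9] -/
theorem publishedInputsX8CoreOfParts_holds : PrintX8VS.PublishedInputsX8CoreOfParts :=
  fun h1 h2 h3 h4 h5 h6 h7 ↦ ⟨h1, h2, h3, h4, h5, h6, h7⟩

end Summit.BirchSwinnertonDyer.BirchSwinnertonDyer.Theorems.PrintX8VSCoreOfParts
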